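import Literature.Analysis.FluidPDE.FluidComputer.ThresholdCrossing
import HarnessLib

/-!
# Fluid computer blueprint — the threshold gate IGNITES in the energy ball (stage 3, theorem form)

HONEST FRAMING: low prior, high value-of-information experiment on Tao's machine paradigm; NOT a
claim that NS blows up. Everything in this file is finite-dimensional ODE theory about a circuit
DESIGN assembled from Tao's quadratic gates (J. Amer. Math. Soc. 29 (2016), §5); nothing is
asserted about the Euler or Navier–Stokes equations.

## The gap this file closes

`ThresholdGate.lean` §6 proves the IGNITION BOUND `IsPreThresholdCurve.ignition_time_le`: a
`δ`-forced orbit which stays loaded (`a > a₀`), past the threshold (`νb(0) - μR = ρ₁ > 0`) and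
un-ignited (`|c| ≤ C`) cannot do so longer than `τ_ign = log(1 + ρ₁C/(σa₀² - δ))/ρ₁`, for every
forcing `δ < σa₀²`. As a statement about the reach layer this has a gap: "stays loaded" is a
HYPOTHESIS on the whole window, whereas the reach layer's working region after the threshold can
only be the energy ball `{|Xᵢ| < R}` — once the gate fires, the rotor DRAINS the carrier, so no
region of the form `{a > a₀}` is invariant over a stage that contains ignition, and the time of
ignition varies with the forcing (the adversary `+e_c` ignites at once).

This file removes the hypothesis: the carrier bound is DERIVED, inside the un-ignited window, from
energy conservation up to the linear drift (`boxTube_subset_preRegion` of `ThresholdCrossing.lean`: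
`a² = E - b² - c² - d² - ã² > a₁²` while clock, trigger and output pair sit in their boxes), by a
bootstrap on the closed condition `a ≥ a₁` (maximal-time exit principle, `ODE/MaximalTime.lean`).
Results, for a curve `x` on `[0,T]` that is continuous, stays in the energy ball and has a
`δ`-admissible right derivative (`‖ẋ - thresholdCircuit … x‖ ≤ δ`) — exactly the three hypotheses
the interface `ReachCertificate.cert` hands to a stage:
* `box_of_unignited` — as long as the trigger has not reached the level `C`, the curve lies in the
  box tube `boxTube … a₁ R C (x 0) t` (carrier `≥ a₁ > a₀`, two-sided clock, `|c| ≤ C`, output pair,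
  energy), under two explicit inequalities on the initial readout (`hER`, `hEa`) and `δ < σa₀²`
  (the trigger barrier at `c = 0`, `trigger_nonneg`);
* `exists_ignition` — **IGNITION IN THE ENERGY BALL**: if moreover the clock is past the band
  (`ρ₁ = νb(0) - μR > 0`), the level `C` is below the clock-stall level (`νC² + δ ≤ εa₀²`) and the
  stage is longer than `τ_ign`, then the trigger REACHES `C` at some time `s ≤ T` — for EVERY
  admissible forcing;
* `exists_first_ignition` — the first such time, with the curve in the box tube up to it: the
  data the transfer stage starts from.
All tolerances are polynomial in the design constants (`δ < σa₀²`, linear drifts), as in §6.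

## What it is NOT

Not the transfer stage (after ignition the rotor must sweep the carrier into the conduit and the
drain into the output with completeness `≥ η₀ - θ` under forcing — numerics only, kit j048231 of
the cell's ASSEMBLY §2k.5), hence not yet a `ReachCertificate` whose hand-off region is "output
loaded": by the remark above, ignition and transfer form ONE stage of the reach layer (working
region = energy ball, REACH existential in time), of which this file proves the first half.
[cite: Tao2016AveragedNS, §5.5 Thm 5.3 (5.5); §5.3 (amp); §1.3 pp. 10–11]
-/

noncomputable section

open Set Filter Topology
open scoped NNReal

namespace Literature.Analysis.FluidPDE.FluidComputer

open Literature.Analysis.FluidPDE.Tao2016AveragedNS Literature.Analysis.ODE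

variable {ε σ ν μ r κ δ a₀ R : ℝ}

/-- **Boxes while un-ignited (carrier bound DERIVED).** Let `x` be continuous on `[0,T]`, stay in
the energy ball `{|Xᵢ| < R}` on `[0,T)` and have a `δ`-admissible right derivative there; start
loaded `a(0) ≥ a₁ > a₀ ≥ 0` with trigger `c(0) ≥ 0`; let `δ < σa₀²`; and let the initial readout
satisfy the energy inequalities `hER` (every mode stays below `R`) and `hEa` (energy conservation
forces `a > a₁` while clock, trigger `≤ C` and output pair sit in their linear boxes over `[0,T]`).
Then on every initial window `[0,t₂]`, `0 < t₂ ≤ T`, on which the trigger stays below `C`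
(`c < C` on `[0,t₂)`), the curve lies in `boxTube ε ν r δ a₁ R C (x 0) t` for all `t ∈ [0,t₂]`.
Proof: bootstrap on the closed condition `a ≥ a₁` (`maximalTimeP`): while it holds the curve is a
pre-threshold curve for `a₀`, so `c ≥ 0` (`trigger_nonneg`), so `|c| ≤ C`, so the §4 boxes hold
(`mem_boxTube`), so `a > a₁` strictly (`boxTube_subset_preRegion`) — and the exit principle
(`eq_of_maximalTimeP_le_const_lt`) forbids an exit before `t₂`.
[cite: Tao2016AveragedNS, §5.5 Thm 5.3 (5.5)] -/
theorem box_of_unignited {x : ℝ → Fin 5 → ℝ} {T t₂ a₁ C : ℝ}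
    (hε : 0 ≤ ε) (hσ : 0 ≤ σ) (hν : 0 ≤ ν) (hr : 0 ≤ r) (hδ : 0 ≤ δ) (hR : 0 ≤ R)
    (ha₀ : 0 ≤ a₀) (ha₁ : a₀ < a₁)
    (hcont : ContinuousOn x (Icc 0 T)) (hU : ∀ t ∈ Ico 0 T, ∀ i, |x t i| < R)
    (hder : ∀ t ∈ Ico 0 T, ∃ V, HasDerivWithinAt x V (Ici t) t ∧
      ‖V - thresholdCircuit ε σ ν μ r κ (x t)‖ ≤ δ)
    (ha : a₁ ≤ x 0 0) (hc0 : 0 ≤ x 0 2) (hs : δ < σ * a₀ ^ 2)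
    (hER : energy (x 0) + 10 * (δ * R) * T < R ^ 2)
    (hEa : a₁ ^ 2 + 10 * (δ * R) * T +
        max |x 0 1 - (ν * C ^ 2 + δ) * T| |x 0 1 + (ε * R ^ 2 + δ) * T| ^ 2 + C ^ 2 +
        (Real.sqrt (x 0 3 ^ 2 + x 0 4 ^ 2) + (r * R * C + 2 * δ) * T) ^ 2 < energy (x 0))
    (ht₂ : t₂ ∈ Ioc 0 T) (hun : ∀ t ∈ Ico 0 t₂, x t 2 < C) :
    ∀ t ∈ Icc 0 t₂, x t ∈ boxTube ε ν r δ a₁ R C (x 0) t := by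
  have hC0 : 0 ≤ C := hc0.trans (hun 0 ⟨le_rfl, ht₂.1⟩).le
  have hc0C : |x 0 2| ≤ C := by rw [abs_of_nonneg hc0]; exact (hun 0 ⟨le_rfl, ht₂.1⟩).le
  -- package: on a sub-window where the carrier bound holds, the boxes hold
  have pkg : ∀ t₃ ∈ Icc 0 t₂, (∀ t ∈ Icc 0 t₃, a₁ ≤ x t 0) →
      ∀ t ∈ Icc 0 t₃, x t ∈ boxTube ε ν r δ a₁ R C (x 0) t := by
    intro t₃ ht₃ hA t ht
    rcases eq_or_lt_of_le ht₃.1 with h0 | hpos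
    · have ht0 : t = 0 := le_antisymm (h0 ▸ ht.2) ht.1
      subst ht0
      exact self_mem_boxTube_zero (x 0) ha hc0C
    · have ht₃T : t₃ ≤ T := ht₃.2.trans ht₂.2
      have h' : IsPreThresholdCurve ε σ ν μ r κ δ a₀ R t₃ x :=
        ⟨hcont.mono (Icc_subset_Icc_right ht₃T),
          fun s hs => ⟨lt_of_lt_of_le ha₁ (hA s (Ico_subset_Icc_self hs)),
            hU s ⟨hs.1, lt_of_lt_of_le hs.2 ht₃T⟩⟩,
          fun s hs => hder s ⟨hs.1, lt_of_lt_of_le hs.2 ht₃T⟩⟩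
      have hnn := h'.trigger_nonneg hσ ha₀ hs hc0
      have hCI : ∀ s ∈ Ico 0 t₃, |x s 2| ≤ C := fun s hs' => by
        rw [abs_of_nonneg (hnn s (Ico_subset_Icc_self hs'))]
        exact (hun s ⟨hs'.1, lt_of_lt_of_le hs'.2 ht₃.2⟩).le
      obtain ⟨-, h1, h2, h3, h4, h5⟩ := h'.mem_boxTube hε hν hr hδ hpos hC0 hCI t ht
      exact ⟨hA t ht, h1, h2, h3, h4, h5⟩
  -- bootstrap on the closed condition `a ≥ a₁` over `[0, t₂]`
  have hg : ContinuousOn (fun t => -x t 0) (Icc 0 t₂) :=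
    ((continuous_apply 0).comp_continuousOn (hcont.mono (Icc_subset_Icc_right ht₂.2))).neg
  have hg0 : -x 0 0 ≤ -a₁ := by linarith
  set t₁ := maximalTimeP (fun s => -x s 0 ≤ -a₁) 0 t₂ with ht₁
  have ht₁mem : t₁ ∈ Icc 0 t₂ := maximalTimeP_le_const_mem ht₂.1.le hg0
  have hspec : ∀ t ∈ Icc 0 t₁, a₁ ≤ x t 0 := fun t ht => by
    have := maximalTimeP_le_const_spec ht₂.1.le hg hg0 ht
    linarith
  have hboxes := pkg t₁ ht₁mem hspec
  suffices hEq : t₁ = t₂ by rw [← hEq]; exact hboxes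
  by_contra hne
  have hlt : t₁ < t₂ := lt_of_le_of_ne ht₁mem.2 hne
  have hexit : -x t₁ 0 = -a₁ := eq_of_maximalTimeP_le_const_lt ht₂.1.le hg hg0 hlt
  have hmem := boxTube_subset_preRegion (a₀ := a₁) (T := T) (t := t₁) hε hν hr hδ hR hC0
    ⟨ht₁mem.1, ht₁mem.2.trans ht₂.2⟩ hER hEa (hboxes t₁ ⟨ht₁mem.1, le_rfl⟩)
  have := hmem.1
  linarith

/-- **IGNITION IN THE ENERGY BALL.** Under the hypotheses of `box_of_unignited` and, in addition,
`μ ≥ 0`, the clock past the band `ρ₁ := νb(0) - μR > 0`, the level `C` below the clock-stall level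
`νC² + δ ≤ εa₀²`, and the stage longer than the ignition time,
`log(1 + ρ₁C/(σa₀² - δ))/ρ₁ < T`: the trigger REACHES the level `C` at some time of `[0,T]` — for
EVERY `δ`-admissible forcing, `δ < σa₀²` (polynomial in the design constants; the
seed-cancellation ceiling is `σ`, `exists_pseudoOrbit_output_zero`). Proof: otherwise
`box_of_unignited` on the whole of `[0,T]` makes the curve a loaded pre-threshold curve, and §6's
`ignition_time_le` bounds `T` by the ignition time. [cite: Tao2016AveragedNS, §5.5 Thm 5.3 (5.5)] -/
theorem exists_ignition {x : ℝ → Fin 5 → ℝ} {T a₁ C : ℝ}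
    (hε : 0 ≤ ε) (hσ : 0 ≤ σ) (hν : 0 ≤ ν) (hμ : 0 ≤ μ) (hr : 0 ≤ r) (hδ : 0 ≤ δ) (hR : 0 ≤ R)
    (ha₀ : 0 ≤ a₀) (ha₁ : a₀ < a₁) (hT : 0 < T)
    (hcont : ContinuousOn x (Icc 0 T)) (hU : ∀ t ∈ Ico 0 T, ∀ i, |x t i| < R)
    (hder : ∀ t ∈ Ico 0 T, ∃ V, HasDerivWithinAt x V (Ici t) t ∧
      ‖V - thresholdCircuit ε σ ν μ r κ (x t)‖ ≤ δ)
    (ha : a₁ ≤ x 0 0) (hc0 : 0 ≤ x 0 2) (hs : δ < σ * a₀ ^ 2)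
    (hER : energy (x 0) + 10 * (δ * R) * T < R ^ 2)
    (hEa : a₁ ^ 2 + 10 * (δ * R) * T +
        max |x 0 1 - (ν * C ^ 2 + δ) * T| |x 0 1 + (ε * R ^ 2 + δ) * T| ^ 2 + C ^ 2 +
        (Real.sqrt (x 0 3 ^ 2 + x 0 4 ^ 2) + (r * R * C + 2 * δ) * T) ^ 2 < energy (x 0))
    (hbal : ν * C ^ 2 + δ ≤ ε * a₀ ^ 2) (hρ₁ : 0 < ν * x 0 1 - μ * R)
    (hτ : Real.log (1 + (ν * x 0 1 - μ * R) * C / (σ * a₀ ^ 2 - δ)) / (ν * x 0 1 - μ * R) < T) :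
    ∃ s ∈ Icc 0 T, C ≤ x s 2 := by
  by_contra hne
  push Not at hne
  have hun : ∀ t ∈ Ico 0 T, x t 2 < C := fun t ht => hne t (Ico_subset_Icc_self ht)
  have hboxes := box_of_unignited hε hσ hν hr hδ hR ha₀ ha₁ hcont hU hder ha hc0 hs hER hEa
    ⟨hT, le_rfl⟩ hun
  have hA : ∀ t ∈ Icc 0 T, a₁ ≤ x t 0 := fun t ht => (hboxes t ht).1
  have h' : IsPreThresholdCurve ε σ ν μ r κ δ a₀ R T x :=
    ⟨hcont, fun s hs' => ⟨lt_of_lt_of_le ha₁ (hA s (Ico_subset_Icc_self hs')), hU s hs'⟩, hder⟩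
  have hnn := h'.trigger_nonneg hσ ha₀ hs hc0
  have hCI : ∀ s ∈ Ico 0 T, |x s 2| ≤ C := fun s hs' => by
    rw [abs_of_nonneg (hnn s (Ico_subset_Icc_self hs'))]; exact (hun s hs').le
  have := h'.ignition_time_le hε hσ hν hμ ha₀ hT hs hc0 hCI hbal hρ₁
  linarith

/-- **First ignition, with the hand-off data.** Under the hypotheses of `exists_ignition` and
`c(0) < C` there is a FIRST time `s ∈ (0,T]` at which the trigger reaches `C`: `c < C` on `[0,s)`,
`c(s) ≥ C`, and up to `s` the curve lies in the box tube `boxTube … a₁ R C (x 0)` (carrier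
`≥ a₁`, clock in its two-sided linear band, `|c| ≤ C`, output pair and energy drift linear) — the
data from which the transfer stage (rotor sweep + drain; not formalised) starts.
[cite: Tao2016AveragedNS, §5.5 Thm 5.3 (5.5)] -/
theorem exists_first_ignition {x : ℝ → Fin 5 → ℝ} {T a₁ C : ℝ}
    (hε : 0 ≤ ε) (hσ : 0 ≤ σ) (hν : 0 ≤ ν) (hμ : 0 ≤ μ) (hr : 0 ≤ r) (hδ : 0 ≤ δ) (hR : 0 ≤ R)
    (ha₀ : 0 ≤ a₀) (ha₁ : a₀ < a₁) (hT : 0 < T)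
    (hcont : ContinuousOn x (Icc 0 T)) (hU : ∀ t ∈ Ico 0 T, ∀ i, |x t i| < R)
    (hder : ∀ t ∈ Ico 0 T, ∃ V, HasDerivWithinAt x V (Ici t) t ∧
      ‖V - thresholdCircuit ε σ ν μ r κ (x t)‖ ≤ δ)
    (ha : a₁ ≤ x 0 0) (hc0 : 0 ≤ x 0 2) (hc0C : x 0 2 < C) (hs : δ < σ * a₀ ^ 2)
    (hER : energy (x 0) + 10 * (δ * R) * T < R ^ 2)
    (hEa : a₁ ^ 2 + 10 * (δ * R) * T +
        max |x 0 1 - (ν * C ^ 2 + δ) * T| |x 0 1 + (ε * R ^ 2 + δ) * T| ^ 2 + C ^ 2 +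
        (Real.sqrt (x 0 3 ^ 2 + x 0 4 ^ 2) + (r * R * C + 2 * δ) * T) ^ 2 < energy (x 0))
    (hbal : ν * C ^ 2 + δ ≤ ε * a₀ ^ 2) (hρ₁ : 0 < ν * x 0 1 - μ * R)
    (hτ : Real.log (1 + (ν * x 0 1 - μ * R) * C / (σ * a₀ ^ 2 - δ)) / (ν * x 0 1 - μ * R) < T) :
    ∃ s ∈ Ioc 0 T, C ≤ x s 2 ∧ (∀ t ∈ Ico 0 s, x t 2 < C) ∧
      ∀ t ∈ Icc 0 s, x t ∈ boxTube ε ν r δ a₁ R C (x 0) t := by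
  set S : Set ℝ := Icc 0 T ∩ x ⁻¹' {X | C ≤ X 2} with hS_def
  have hSne : S.Nonempty := by
    obtain ⟨s, hs', hCs⟩ := exists_ignition hε hσ hν hμ hr hδ hR ha₀ ha₁ hT hcont hU hder ha hc0
      hs hER hEa hbal hρ₁ hτ
    exact ⟨s, hs', hCs⟩
  have hSc : IsClosed S :=
    hcont.preimage_isClosed_of_isClosed isClosed_Icc
      (isClosed_le continuous_const (continuous_apply 2))
  have hSb : BddBelow S := ⟨0, fun s hs' => hs'.1.1⟩
  set s₀ := sInf S with hs₀
  have hs₀S : s₀ ∈ S := hSc.csInf_mem hSne hSb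
  have hCs₀ : C ≤ x s₀ 2 := hs₀S.2
  have hun : ∀ t ∈ Ico 0 s₀, x t 2 < C := by
    intro t ht
    by_contra hge
    rw [not_lt] at hge
    have htS : t ∈ S := ⟨⟨ht.1, ht.2.le.trans hs₀S.1.2⟩, hge⟩
    exact absurd (csInf_le hSb htS) (not_le.2 ht.2)
  have hs₀pos : 0 < s₀ := by
    rcases eq_or_lt_of_le hs₀S.1.1 with h0 | hpos
    · exfalso; rw [← h0] at hCs₀; linarith
    · exact hpos
  exact ⟨s₀, ⟨hs₀pos, hs₀S.1.2⟩, hCs₀, hun,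
    box_of_unignited hε hσ hν hr hδ hR ha₀ ha₁ hcont hU hder ha hc0 hs hER hEa ⟨hs₀pos, hs₀S.1.2⟩
      hun⟩

end Literature.Analysis.FluidPDE.FluidComputer

end
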